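import Summits.BirchSwinnertonDyer.Rank1Residual.O5.HeegnerLogTransportThreeStepZeroEndTwoSided
import Summits.BirchSwinnertonDyer.Rank1Residual.O5.HeegnerLogTransportThreeLogUnitCertCore
import Summits.BirchSwinnertonDyer.Rank1Residual.Supersingular.RationalLadder
import HarnessLib
import HarnessLib.Audit.Tags

/-!
# Heegner-log transport at `p = 3` (KL3), part 25b: the two-sided END's unit-log binder as a KERNEL
# CERTIFICATE (rational multiple `m • Q₀ = (x_R, y_R)`, `ord₃ x_R = −2k`, part 24 core) with the tree's
# rational LADDER as division-free front-end — o5-r2 GEN 27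

HONEST FRAMING (cell `b2b-bsdres`, run/shared/lean/b2b/bsd-rank1-residual/, verbatim in every file): the
goal of the cell is to DELETE the COMBINATION-SHAPED residual classes of the Birch–Swinnerton-Dyer formula
for ALL analytic-rank `≤ 1` elliptic curves over `ℚ` — "full BSD formula for every rank `≤ 1` curve in
class `C`" assembled STRICTLY from published theorems — so that the rank-`≤ 1` remainder becomes exactly
the CONSTRUCTION-SHAPED classes, which are TYPED (missing-input `Prop`s), NOT attempted. This is not
"finishing BSD". Team O5 (tame potentially supersingular additive `p = 3`, (t′)), planner o5-r2 (the
non-Iwasawa side), GEN 27; RESEARCH ROUTE; THEOREMS ONLY (bookkeeping over explicit hypotheses): no new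
node is WANTED, no Literature fact, no `@[conjecture]`, no new object; NOTHING is booked and no mark of
`RESIDUAL-MAP.md` moves. O5 OPEN.

## What this file does

Part 25 (`O5/HeegnerLogTransportThreeStepZeroEndTwoSided.lean`, theorem
`o5_index_unit_of_goodOrd_companion_cited_s0d_rat`) displays the companion-side unit-log binder as a statement
about a rational point `Q₀ ∈ G(ℚ)`: `ord₃ padicLog_{G ⊗ ℚ₃}(Q₀ ⊗ ℚ₃) + ord₃ |G̃^{ns}(𝔽₃)| − 1 = 0`. Part 24 core
(`O5/HeegnerLogTransportThreeLogUnitCertCore.lean`, `valuation_padicLog_of_nsmul_eq`: for ODD `p`,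
`m • Q = (x_R, y_R)` with `ord_p x_R = −2k`, `k ≥ 1` ⇒ `padicLog Q ≠ 0 ∧ ord_p padicLog Q = k − ord_p m`) makes it
a FINITE EXACT COMPUTATION: §3 takes `m • Q₀ = (x_R, y_R)`, `0 < k`, `padicValRat 3 x_R = −2k` and the numeral
identity `k − ord₃ m + ord₃ |G̃^{ns}(𝔽₃)| − 1 = 0` (and PROVES `Q₀` has infinite order); §4 supplies the point
equality by the tree's rational ladder (`Supersingular.nsmul_some_eq_of_ladderRunQ`, `decide +kernel` per row).
For the census row of record GEN 27 (`W = 240930b1`, `G = 26770a1 = [1,1,0,−1372,17984]`, `K = ℚ(√−551)`):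
`Q₀ = (28, 36)`, `m = |G̃(𝔽₃)| = 5` (`a₃(G) = −1`, non-anomalous), `5 • Q₀ = (3052/9, −172528/27)`,
`ord₃ (3052/9) = −2` ⇒ `k = 1`, `1 − 0 + 0 − 1 = 0` (EVIDENCE `gen27/census/KL3-Bfamily-eligibility-o5r2-g27.tsv`;
the row instance is GEN 28's docket, after this file is in the tree).

## TYPER PLACEMENT NOTE

Place as `O5/HeegnerLogTransportThreeStepZeroEndTwoSidedCert.lean` AFTER part 25
(`O5/HeegnerLogTransportThreeStepZeroEndTwoSided.lean`, o5-r2 GEN 27) and part 24 core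
(`O5/HeegnerLogTransportThreeLogUnitCertCore.lean`, in the tree 2026-08-23T09:21Z), plus
`Supersingular/RationalLadder.lean` (in the tree), which this file imports; THEOREMS only, namespace
`Summit.BirchSwinnertonDyer.Rank1Residual.O5.HeegnerLogTransport`; no `def`. CONTENT LABELS: THEOREMS ONLY — 0 `def`,
0 `@[conjecture]`, 0 Literature facts (net named-fact debt 0), no `sorry`; published inputs stay displayed hypotheses
BY NAME. HONEST FRAMING as above; census = EVIDENCE, never a Literature fact; O5 OPEN; nothing booked.

### cc-typer-5 GEN 20 (O5 §3.5 / O6 §3.4 typer of record) — by-name ask A-O5-G27-1 of o5-r2 GEN 27, HOME/INBOX.md l.14993: 'PART 25 e7e96b464eb0a381 → NEW leaf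
`O5/HeegnerLogTransportThreeStepZeroEndTwoSided.lean` THEN 25b 21a4ca507ba962b9 → `O5/HeegnerLogTransportThreeStepZeroEndTwoSidedCert.lean` THEN 25c d313241b3ce88d9b →
`O5/HeegnerLogTransportThreeTwoSidedRow240930b1.lean` (by sha, byte-identical + your ¶, or not at all)'; memo `HOME/b2b-bsdres-o5-r2/gen27/O5-GEN27.md` fb9f7e33bc3d18a4;
order of record after this seat's parts 20 / 20b / 21 / (a) / 23 / 24 CORE+CERT / 24b: 25 → 25b → 25c.

Source: `HOME/b2b-bsdres-o5-r2/gen27/lean/HeegnerLogTransportThreeStepZeroEndTwoSidedCert.lean` sha16 `21a4ca507ba962b9` (176 l.; `gen27/SHA16.txt`; o5-r2's joint scratches as in part 25, rc 0, axioms standard), re-hashed by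
the typer right before writing; THIS file = KL3 part 25b = the source VERBATIM + this paragraph (imports, module text, every declaration block byte-identical; script
`class-closure/typer-5/gen20/g27_place.py`, docstring anchor asserted); imports part 25 `…StepZeroEndTwoSided` (p361579, this seat), part 24 CORE `…LogUnitCertCore`
(p359674, this seat) and `Supersingular.RationalLadder` — all in the tree; the typer's own standalone farm check on tree imports (after part 25's olean; rc 0 / 0 warnings /
0 sorries; `#print axioms` of both ENDs standard) and DEDUP (`lean search --decl` on the 2 new names: no match) precede the proposal.
CONTENT LABELS (source, unchanged): THEOREMS ONLY (2: `o5_index_unit_of_goodOrd_companion_cited_s0d_cert` — part 25's END with the unit-log datum REPLACED by a rational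
multiple certificate `m • Q₀ = (x_R, y_R)`, `ord_3 x_R = −2k`, via part 24 §3–§4; `…_cited_s0d_ladder` — the same by a tree LADDER + `logUnitOKQ`-shape check, both
`decide +kernel` per row), 0 `def`, 0 `@[conjecture]`, 0 Literature facts (net named-fact debt 0), no `sorry`; displayed inputs BY NAME as in part 25, nothing re-proved.
HONEST FRAMING (cell `b2b-bsdres`): research route, lane CLASS-CLOSURE §3.5 O5; CONDITIONAL ENDs — nothing asserted beyond the displayed binders, nothing booked, no
mark / label / count / tier of `RESIDUAL-MAP.md` moves; census (FINDING A / B of the memo: END-eligibility 0 / 870, B-family 3 / 870) = EVIDENCE, never a Literature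
fact; O5 OPEN.
-/

set_option autoImplicit false

noncomputable section

open scoped Classical

open WeierstrassCurve Literature.NumberTheory.EllipticCurves
  Literature.NumberTheory.EllipticCurves.ModularForms
  Literature.NumberTheory.EllipticCurves.Rank1Residual
  Literature.NumberTheory.EllipticCurves.Rank1Residual.Typed
open Summit.BirchSwinnertonDyer.Rank1Residual.X11b (embAt)
open Summit.BirchSwinnertonDyer.Rank1Residual.Additive.LocalLog
open IsDedekindDomain (HeightOneSpectrum)
open scoped NumberField

namespace Summit.BirchSwinnertonDyer.Rank1Residual.O5.HeegnerLogTransport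

/-! ## §3 The unit-log binder as a KERNEL CERTIFICATE: a rational multiple `m • Q₀ = (x_R, y_R)` (part 24 §3) -/

/-- **Two-sided END, rational-multiple certificate.** §2 with `hQ₀`, `hQ₀unit` REPLACED by: `m • Q₀ = (x_R, y_R) ∈ G(ℚ)`
with `ord₃ x_R = −2k`, `0 < k`, and the arithmetic side condition `k − ord₃ m + ord₃ |G̃^{ns}(𝔽₃)| − 1 = 0` (for the
natural choice `m = |G̃(𝔽₃)|`, `k = 1` it reads `0 = 0`). Part 24's `valuation_padicLog_of_nsmul_eq` (odd `p`:
`ord_p padicLog Q₀ = k − ord_p m`, and `padicLog Q₀ ≠ 0`, so `Q₀` has infinite order) turns these into §2's binders.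
Every hypothesis on `Q₀` is now an identity between rational numerals. [cite: SilvermanAEC2009, IV.6.4 and VII.2.2]
[cite: Castella2018, §2.2 and Thm. 2.3 (arXiv:1704.06608 p. 5)] [cite: KrizLi2019, Thm. 1.16, Rem. 1.17] -/
theorem o5_index_unit_of_goodOrd_companion_cited_s0d_cert
    (hKL : KrizLi2019.thm116_padicLogHeegner_congruence)
    (hYZ : YanZhu2026.thm415_padicValRat_bsd_rank_le_one)
    (hW20 : Wuthrich2014.lemma20_surjective_threeAdic_of_semistable)
    (hmod : exists_isNewformOf) (hGZK : rank_eq_analyticRank_of_analyticRank_le_one)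
    (W G : WeierstrassCurve ℚ) [W.IsElliptic] [W.IsGloballyMinimal] [G.IsElliptic] [G.IsGloballyMinimal]
    (hcong : ∀ ℓ : ℕ, ℓ.Prime → ¬ (ℓ ∣ 3 * W.conductorNorm ℤ * G.conductorNorm ℤ) →
      ((W.LFunction ℓ : ℤ) : ZMod 3) = ((G.LFunction ℓ : ℤ) : ZMod 3))
    (hρ : W.HasSurjectiveModNGaloisRep 3) (hadd : Addv W 3)
    (hunitW : ∀ ℓ ∈ klSet W G, ℓ ≠ 3 → padicValInt 3 (nsCount W ℓ) = 0)
    (hunitG : ∀ ℓ ∈ klSet G W, ℓ ≠ 3 → padicValInt 3 (nsCount G ℓ) = 0)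
    (htam : ¬ 3 ∣ W.tamagawaProduct) (htamG : ¬ 3 ∣ G.tamagawaProduct) (hordG : GoodOrd G 3)
    (Gd : WeierstrassCurve ℚ) [Gd.IsElliptic] [Gd.IsGloballyMinimal] (htamGd : ¬ 3 ∣ Gd.tamagawaProduct)
    {N N' : ℕ} [NeZero N] [NeZero N'] (D : ModularParametrizationData W N)
    (D' : ModularParametrizationData G N')
    (K : Type) [Field K] [NumberField K] (hK : IsImaginaryQuadratic K)
    (hH : SatisfiesHeegnerHypothesis N K) (hH' : SatisfiesHeegnerHypothesis N' K)
    (h3K : SatisfiesHeegnerHypothesis 3 K)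
    (hKoG : kolyvagin N' G K) (hGZG : gross_zagier N' G K)
    (hd : NumberField.discr K < -4)
    (hGd : ∃ C : VariableChange ℚ, C • G.quadraticTwist (NumberField.discr K : ℚ) = Gd)
    (H : HeegnerDatum N (NumberField.discr K)) (H' : HeegnerDatum N' (NumberField.discr K))
    (ι : K →+* ℂ) (ι₃ : K →+* ℚ_[3])
    (P : (W.baseChange K).toAffine.Point) (P' : (G.baseChange K).toAffine.Point)
    (hP : WeierstrassCurve.Affine.Point.map ι.toRatAlgHom P = heegnerPointComplex D H)
    (hP' : WeierstrassCurve.Affine.Point.map ι.toRatAlgHom P' = heegnerPointComplex D' H')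
    (hPinf : ¬ IsOfFinAddOrder P) (hP'inf : ¬ IsOfFinAddOrder P')
    (Q₀ : G.toAffine.Point) {xR yR : ℚ} {hR : G.toAffine.Nonsingular xR yR} {m k : ℕ}
    (hm : m • Q₀ = .some xR yR hR) (hk : 0 < k) (hx : padicValRat 3 xR = -(2 * (k : ℤ)))
    (hmk : (k : ℤ) - padicValNat 3 m + padicValInt 3 (nsCount G 3) - 1 = 0)
    (hSelG : Nat.card (G.selmerGroup (3 : ℤ)) = 3 ^ G.mordellWeilRank)
    (hSelGd : Nat.card (Gd.selmerGroup (3 : ℤ)) = 3 ^ Gd.mordellWeilRank)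
    (hcD : padicValInt 3 D.maninConstant = 0) (hc3' : ¬ ((3 : ℤ) ∣ D'.maninConstant)) :
    padicValNat 3 (AddSubgroup.zmultiples P).index = 0 := by
  haveI : Fact (Nat.Prime 3) := ⟨Nat.prime_three⟩
  have hm' : m • Affine.Point.map (W' := G.toAffine) (S := ℚ) (Algebra.ofId ℚ ℚ_[3]) Q₀ =
      Affine.Point.map (W' := G.toAffine) (S := ℚ) (Algebra.ofId ℚ ℚ_[3]) (.some xR yR hR) := by
    rw [← map_nsmul]; exact congrArg _ hm
  rw [Affine.Point.map_some] at hm'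
  have hx' : ((Algebra.ofId ℚ ℚ_[3]) xR).valuation = -(2 * (k : ℤ)) := by
    rw [show (Algebra.ofId ℚ ℚ_[3]) xR = (xR : ℚ_[3]) from eq_ratCast _ xR, Padic.valuation_ratCast, hx]
  obtain ⟨hnt, hval⟩ :=
    valuation_padicLog_of_nsmul_eq (G.baseChange ℚ_[3]) (by norm_num) hm' hk hx'
  have hQ₀ : ¬ IsOfFinAddOrder Q₀ := fun h =>
    hnt ((padicLog_eq_zero_iff (G.baseChange ℚ_[3]) _).mpr (AddMonoidHom.isOfFinAddOrder _ h))
  have hQ₀unit : (padicLog (G.baseChange ℚ_[3])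
        (Affine.Point.map (W' := G.toAffine) (S := ℚ) (Algebra.ofId ℚ ℚ_[3]) Q₀)).valuation +
      padicValInt 3 (nsCount G 3) - 1 = 0 := by
    rw [hval]; exact hmk
  exact o5_index_unit_of_goodOrd_companion_cited_s0d_rat hKL hYZ hW20 hmod hGZK W G hcong hρ hadd hunitW
    hunitG htam htamG hordG Gd htamGd D D' K hK hH hH' h3K hKoG hGZG hd hGd H H' ι ι₃ P P' hP hP' hPinf hP'inf
    Q₀ hQ₀ hQ₀unit hSelG hSelGd hcD hc3'

/-! ## §4 Division-free front-end: the multiple by a tree LADDER (`Supersingular.ladderRunQ`, `decide +kernel`) -/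

/-- **Two-sided END, ladder form of the unit-log certificate.** §3 with the point equality `m • Q₀ = (x_R, y_R)`
SUPPLIED by the tree's rational ladder: a base point `(x₀, y₀) ∈ G(ℚ)` (`h₀`, `decide`), a list of ladder steps
replayed by `Supersingular.ladderRunQ` to `(x_f, y_f)` (`hrun`, `decide +kernel`), `m = qScalar 1 steps`, and the
two numeral checks `padicValRat 3 x_f = −2k`, `k − ord₃ m + ord₃ |G̃^{ns}(𝔽₃)| − 1 = 0`. For a good ordinary companion
take `m = |G̃(𝔽₃)| ∈ {2, 4, 5, 7}` (non-anomalous, `k = 1`, one or two ladder steps) or `m ∈ {3, 6}` (anomalous,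
`k = 1`). [cite: SilvermanAEC2009, III.2.3, IV.6.4 and VII.2.2] [cite: KrizLi2019, Thm. 1.16, Rem. 1.17] -/
theorem o5_index_unit_of_goodOrd_companion_cited_s0d_ladder
    (hKL : KrizLi2019.thm116_padicLogHeegner_congruence)
    (hYZ : YanZhu2026.thm415_padicValRat_bsd_rank_le_one)
    (hW20 : Wuthrich2014.lemma20_surjective_threeAdic_of_semistable)
    (hmod : exists_isNewformOf) (hGZK : rank_eq_analyticRank_of_analyticRank_le_one)
    (W G : WeierstrassCurve ℚ) [W.IsElliptic] [W.IsGloballyMinimal] [G.IsElliptic] [G.IsGloballyMinimal]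
    (hcong : ∀ ℓ : ℕ, ℓ.Prime → ¬ (ℓ ∣ 3 * W.conductorNorm ℤ * G.conductorNorm ℤ) →
      ((W.LFunction ℓ : ℤ) : ZMod 3) = ((G.LFunction ℓ : ℤ) : ZMod 3))
    (hρ : W.HasSurjectiveModNGaloisRep 3) (hadd : Addv W 3)
    (hunitW : ∀ ℓ ∈ klSet W G, ℓ ≠ 3 → padicValInt 3 (nsCount W ℓ) = 0)
    (hunitG : ∀ ℓ ∈ klSet G W, ℓ ≠ 3 → padicValInt 3 (nsCount G ℓ) = 0)
    (htam : ¬ 3 ∣ W.tamagawaProduct) (htamG : ¬ 3 ∣ G.tamagawaProduct) (hordG : GoodOrd G 3)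
    (Gd : WeierstrassCurve ℚ) [Gd.IsElliptic] [Gd.IsGloballyMinimal] (htamGd : ¬ 3 ∣ Gd.tamagawaProduct)
    {N N' : ℕ} [NeZero N] [NeZero N'] (D : ModularParametrizationData W N)
    (D' : ModularParametrizationData G N')
    (K : Type) [Field K] [NumberField K] (hK : IsImaginaryQuadratic K)
    (hH : SatisfiesHeegnerHypothesis N K) (hH' : SatisfiesHeegnerHypothesis N' K)
    (h3K : SatisfiesHeegnerHypothesis 3 K)
    (hKoG : kolyvagin N' G K) (hGZG : gross_zagier N' G K)
    (hd : NumberField.discr K < -4)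
    (hGd : ∃ C : VariableChange ℚ, C • G.quadraticTwist (NumberField.discr K : ℚ) = Gd)
    (H : HeegnerDatum N (NumberField.discr K)) (H' : HeegnerDatum N' (NumberField.discr K))
    (ι : K →+* ℂ) (ι₃ : K →+* ℚ_[3])
    (P : (W.baseChange K).toAffine.Point) (P' : (G.baseChange K).toAffine.Point)
    (hP : WeierstrassCurve.Affine.Point.map ι.toRatAlgHom P = heegnerPointComplex D H)
    (hP' : WeierstrassCurve.Affine.Point.map ι.toRatAlgHom P' = heegnerPointComplex D' H')
    (hPinf : ¬ IsOfFinAddOrder P) (hP'inf : ¬ IsOfFinAddOrder P')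
    {x₀ y₀ xf yf : ℚ} (h₀ : G.toAffine.Nonsingular x₀ y₀) (steps : List Supersingular.QStep)
    (hrun : Supersingular.ladderRunQ G.a₁ G.a₂ G.a₃ G.a₄ x₀ y₀ x₀ y₀ steps = some (xf, yf))
    {k : ℕ} (hk : 0 < k) (hx : padicValRat 3 xf = -(2 * (k : ℤ)))
    (hmk : (k : ℤ) - padicValNat 3 (Supersingular.qScalar 1 steps) + padicValInt 3 (nsCount G 3) - 1 = 0)
    (hSelG : Nat.card (G.selmerGroup (3 : ℤ)) = 3 ^ G.mordellWeilRank)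
    (hSelGd : Nat.card (Gd.selmerGroup (3 : ℤ)) = 3 ^ Gd.mordellWeilRank)
    (hcD : padicValInt 3 D.maninConstant = 0) (hc3' : ¬ ((3 : ℤ) ∣ D'.maninConstant)) :
    padicValNat 3 (AddSubgroup.zmultiples P).index = 0 := by
  obtain ⟨hf, hm⟩ := Supersingular.nsmul_some_eq_of_ladderRunQ h₀ steps hrun
  exact o5_index_unit_of_goodOrd_companion_cited_s0d_cert hKL hYZ hW20 hmod hGZK W G hcong hρ hadd hunitW
    hunitG htam htamG hordG Gd htamGd D D' K hK hH hH' h3K hKoG hGZG hd hGd H H' ι ι₃ P P' hP hP' hPinf hP'inf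
    (.some x₀ y₀ h₀) hm hk hx hmk hSelG hSelGd hcD hc3'

end Summit.BirchSwinnertonDyer.Rank1Residual.O5.HeegnerLogTransport

end
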